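import Summits.BirchSwinnertonDyer.Rank1Residual.P2.CellsAtTwoStatus
import Literature.NumberTheory.EllipticCurves.HeathBrown1994.CongruentTwoSelmerMonskyMatrix
import Literature.NumberTheory.EllipticCurves.BSDWave0TunnellProofs
import Literature.NumberTheory.EllipticCurves.ComplexMultiplicationHasCMProofs
import Literature.NumberTheory.EllipticCurves.LFunctionSmulProofs
import Mathlib.LinearAlgebra.Matrix.Notation
import Mathlib.Algebra.CharP.Two
import HarnessLib

/-!
# Sub-lane «bsd-p2»: PAIRS `(E_n, 2)` CLOSED IN THE KERNEL — the congruent-number twists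
# `E_n : y² = x³ − n²x` with `s(n) = 0`, membership decided by `decide` on Monsky's matrix
# (doors D-CN-1′ journal / D-CN-1 [PRE] of the Monsky sub-cell; p2-lead T-25 / T-25′ / ME-6 / ME-10)

HONEST FRAMING (sub-lane «bsd-p2», run/shared/lean/b2b/bsd-rank1-residual/p2/, verbatim in every
file): the target of record is the FULL Birch–Swinnerton-Dyer formula for EVERY analytic-rank `≤ 1`
`E/ℚ` at ALL primes INCLUDING `2`; the odd-prime class ledger is referee A's; the `2`-part is OPEN
(cells O1 = X5 ∖ CM and O12 = the CM corner) and under census by «bsd-p2». Census / instrument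
output at `2` = EVIDENCE / conjecture items with held-out validation, NEVER a Literature fact;
certificates close PAIRS (one isogeny class, `p = 2`), never classes. This file asserts NO
arithmetic fact and proves no door of its own: the doors are the lit seats' —
* JOURNAL door (p2-monsky-lit, `HeathBrown1994/CongruentTwoSelmerMonskyMatrix.lean` §6, p318474:
  `forall_bsdp_of_monsky_of_BT_BF_odd/even`): Monsky 1994 (`#Sel₂(E_n) = 2^{2+s(n)}`, as printed,
  `monsky_card_selmerGroup_two_odd/even`) + `det M = 1` ⇒ `#Sel₂(E_n) = 4` ⇒ (tree theorems of
  p2-lit-1's `Smith2016/CongruentNumberBSDSelmerRankTwoProofs.lean`: `rank = 0`, `Ш[2^∞] = 0`) ⇒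
  Burungale–Tian 2026 Thm 1.1 (`hBT`, CM rank-zero `p`-converse at `p = 2`) + Deuring–Hecke (`hH`) +
  Burungale–Flach 2024 Cor 2 (`hBF`) ⇒ RANK ∧ SHAFIN ∧ LEAD ⇒ `BSD(E_n, ℓ)` for every `ℓ`;
* [PRE] door (D-CN-1): Monsky + Smith 2016 Cor 1.3 (`bsdTriple_of_monsky_of_smith_odd/even`).
WHAT THIS FILE ADDS (the typer's part, one writer of `P2/`): §1 the doors in the lane's currency
`BSDp (congruentNumberCurve n) 2` with the product `∏ pᵢ` rewritten to the NUMERAL `n` (so that an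
instance reads `BSDp (congruentNumberCurve 33) 2`), §2 WHERE THE PAIRS SIT — `E_n` has CM by `ℤ[i]`
(`j = 1728`), `2` RAMIFIED in `ℚ(i)`, analytic rank `0` once the door is through: cell status
`coveredC8` (Burungale–Flach covers every CM curve with `L(E,1) ≠ 0`), so the doors add NO cell; what
they add is that MEMBERSHIP (`r_an(E_n) = 0`, i.e. which `n`) is decided by a kernel `decide` on a
printed matrix instead of an `L`-value — the pair closes with no analytic input ('kernel-certified'
in the lead's U-27 sense, as opposed to 'engine-certified'); §3 a `ℤ/2` numeral lemma for the
instance files. Instances `n ∈ U_CN` (conductor `< 5·10⁵`, `s(n) = 0`; the 29 rows of p2-monsky-eng's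
`p2/monsky/eng/dry/step0-bypro/U_CN.minor-certs.tsv`, matrices re-derived independently and
re-checked entry by entry in the kernel) are in the sequels `P2/CongruentNumberPairsAtTwoOdd.lean`
(17) and `P2/CongruentNumberPairsAtTwoEven.lean` (12). Per-pair statements; they close no class.
Nothing booked; no mark moved. Unit `b2b-bsdres-p2-typer` GEN 3 (p2-lead T-25, T-25′, ME-6, ME-10,
T-30); NEW file.

References: Heath-Brown, Invent. Math. 118 (1994), Appendix by Monsky (typescript pp. 38–42)
[HeathBrown1994SelmerCongruentII]; Burungale–Tian, Ann. of Math. 203 (2026) Thm 1.1 [BurungaleTian2026];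
Burungale–Flach, Camb. J. Math. 12 (2024) Cor 2 [BurungaleFlach2024]; Smith, arXiv:1603.08479 Cor 1.3
[Smith2016CongruentDensity]; Miller 2011 Def 1.1 [Miller2011LMS]; HOME/p2/monsky/KICKOFF.md ADDENDUM 1;
HOME/p2/LEAD-OKS.md T-25 / T-25′ / ME-6 / ME-10 / T-30 / U-27.
-/

noncomputable section

open scoped Classical

open Matrix WeierstrassCurve Literature.NumberTheory.EllipticCurves
  Literature.NumberTheory.EllipticCurves.Rank1Residual
  Literature.NumberTheory.EllipticCurves.Rank1Residual.Typed
  Literature.NumberTheory.EllipticCurves.HeathBrown1994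

set_option autoImplicit false

namespace Summit.BirchSwinnertonDyer.Rank1Residual.P2

/-! ## §1 The doors in the lane's currency, product rewritten to the numeral -/

section Monsky

variable {k : ℕ} (p : Fin k → ℕ)

/-- **JOURNAL door, odd `n = p₁⋯p_k`** (p2-monsky-lit's `forall_bsdp_of_monsky_of_BT_BF_odd` at
`ℓ = 2`, with `∏ pᵢ` rewritten to the numeral `n` by `hn`): Monsky's theorem (`hM`) + `det M = 1` +
Burungale–Tian 2026 Thm 1.1 (`hBT`) + Deuring–Hecke (`hH`) + Burungale–Flach 2024 Cor 2 (`hBF`) ⇒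
`BSD(E_n, 2)`. [cite: HeathBrown1994SelmerCongruentII, Appendix (Monsky), typescript p. 39 L10–L33]
[cite: BurungaleTian2026, Thm. 1.1] [cite: BurungaleFlach2024, Thm 1.1 and Cor. 2] -/
theorem bsdp_two_congruentNumberCurve_of_det_odd (hM : monsky_card_selmerGroup_two_odd)
    (hBT : burungaleTian_analyticRank_eq_zero_of_selmerCorank_eq_zero_of_hasCM)
    (hH : hasEntireLFunction_of_j_mem_maximalCMJInvariants)
    (hBF : bsdTriple_of_hasCM_of_L_one_ne_zero)
    (hp : ∀ i, (p i).Prime) (hodd : ∀ i, Odd (p i)) (hinj : Function.Injective p)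
    (hdet : (monskyMatrixOdd p).det = 1) {n : ℕ} (hn : ∏ i, p i = n) :
    BSDp (congruentNumberCurve n) 2 := by
  subst hn
  exact forall_bsdp_of_monsky_of_BT_BF_odd p hM hBT hH hBF hp hodd hinj hdet 2 Nat.prime_two

/-- **JOURNAL door, even `n = 2p₁⋯p_k`** (`forall_bsdp_of_monsky_of_BT_BF_even` at `ℓ = 2`).
[cite: HeathBrown1994SelmerCongruentII, Appendix (Monsky), typescript p. 41 L20–L36]
[cite: BurungaleTian2026, Thm. 1.1] [cite: BurungaleFlach2024, Thm 1.1 and Cor. 2] -/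
theorem bsdp_two_congruentNumberCurve_of_det_even (hM : monsky_card_selmerGroup_two_even)
    (hBT : burungaleTian_analyticRank_eq_zero_of_selmerCorank_eq_zero_of_hasCM)
    (hH : hasEntireLFunction_of_j_mem_maximalCMJInvariants)
    (hBF : bsdTriple_of_hasCM_of_L_one_ne_zero)
    (hp : ∀ i, (p i).Prime) (hodd : ∀ i, Odd (p i)) (hinj : Function.Injective p)
    (hdet : (monskyMatrixEven p).det = 1) {n : ℕ} (hn : 2 * ∏ i, p i = n) :
    BSDp (congruentNumberCurve n) 2 := by
  subst hn
  exact forall_bsdp_of_monsky_of_BT_BF_even p hM hBT hH hBF hp hodd hinj hdet 2 Nat.prime_two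

/-- The journal door with the MODULARITY leaf (`hasEntireLFunction_rat`, the lane's usual binder) in
place of Deuring–Hecke (of which it is a special case,
`hasEntireLFunction_of_j_mem_maximalCMJInvariants_of_hasEntireLFunction_rat`), odd `n`.
[cite: BurungaleTian2026, Thm. 1.1] [cite: BurungaleFlach2024, Cor. 2] [cite: BCDTJAMS2001, Theorem A] -/
theorem bsdp_two_congruentNumberCurve_of_det_odd' (hM : monsky_card_selmerGroup_two_odd)
    (hBT : burungaleTian_analyticRank_eq_zero_of_selmerCorank_eq_zero_of_hasCM)
    (hmod : hasEntireLFunction_rat) (hBF : bsdTriple_of_hasCM_of_L_one_ne_zero)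
    (hp : ∀ i, (p i).Prime) (hodd : ∀ i, Odd (p i)) (hinj : Function.Injective p)
    (hdet : (monskyMatrixOdd p).det = 1) {n : ℕ} (hn : ∏ i, p i = n) :
    BSDp (congruentNumberCurve n) 2 :=
  bsdp_two_congruentNumberCurve_of_det_odd p hM hBT
    (hasEntireLFunction_of_j_mem_maximalCMJInvariants_of_hasEntireLFunction_rat hmod) hBF hp hodd
    hinj hdet hn

/-- The journal door with the modularity leaf, even `n`. [cite: BurungaleTian2026, Thm. 1.1]
[cite: BurungaleFlach2024, Cor. 2] [cite: BCDTJAMS2001, Theorem A] -/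
theorem bsdp_two_congruentNumberCurve_of_det_even' (hM : monsky_card_selmerGroup_two_even)
    (hBT : burungaleTian_analyticRank_eq_zero_of_selmerCorank_eq_zero_of_hasCM)
    (hmod : hasEntireLFunction_rat) (hBF : bsdTriple_of_hasCM_of_L_one_ne_zero)
    (hp : ∀ i, (p i).Prime) (hodd : ∀ i, Odd (p i)) (hinj : Function.Injective p)
    (hdet : (monskyMatrixEven p).det = 1) {n : ℕ} (hn : 2 * ∏ i, p i = n) :
    BSDp (congruentNumberCurve n) 2 :=
  bsdp_two_congruentNumberCurve_of_det_even p hM hBT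
    (hasEntireLFunction_of_j_mem_maximalCMJInvariants_of_hasEntireLFunction_rat hmod) hBF hp hodd
    hinj hdet hn

/-- **[PRE] door (D-CN-1), odd `n`**: Monsky + Smith 2016 Cor 1.3 (arXiv preprint, `hS`) +
`det M = 1` ⇒ `BSD(E_n, 2)` (p2-monsky-lit's `bsdTriple_of_monsky_of_smith_odd` in the lane's
currency). Counted on its own PRE line, never merged with the journal door (p2-lead U-25).
[cite: Smith2016CongruentDensity, Cor. 1.3 (arXiv:1603.08479 chunk p0003 L39–L44)]
[cite: HeathBrown1994SelmerCongruentII, Appendix (Monsky), typescript p. 39 L10–L33] -/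
theorem bsdp_two_congruentNumberCurve_of_det_odd_smith (hM : monsky_card_selmerGroup_two_odd)
    (hS : Smith2016.cor13_bsd_of_selmerRankTwo)
    (hp : ∀ i, (p i).Prime) (hodd : ∀ i, Odd (p i)) (hinj : Function.Injective p)
    (hdet : (monskyMatrixOdd p).det = 1) {n : ℕ} (hn : ∏ i, p i = n) :
    BSDp (congruentNumberCurve n) 2 := by
  subst hn
  haveI := isElliptic_congruentNumberCurve
    (Squarefree.ne_zero (squarefree_prod_of_injective p hp hinj))
  exact forall_bsdp_of_bsdTriple' _ (bsdTriple_of_monsky_of_smith_odd p hM hS hp hodd hinj hdet).1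
    2 Nat.prime_two

/-- **[PRE] door (D-CN-1), even `n`.** [cite: Smith2016CongruentDensity, Cor. 1.3]
[cite: HeathBrown1994SelmerCongruentII, Appendix (Monsky), typescript p. 41 L20–L36] -/
theorem bsdp_two_congruentNumberCurve_of_det_even_smith (hM : monsky_card_selmerGroup_two_even)
    (hS : Smith2016.cor13_bsd_of_selmerRankTwo)
    (hp : ∀ i, (p i).Prime) (hodd : ∀ i, Odd (p i)) (hinj : Function.Injective p)
    (hdet : (monskyMatrixEven p).det = 1) {n : ℕ} (hn : 2 * ∏ i, p i = n) :
    BSDp (congruentNumberCurve n) 2 := by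
  subst hn
  haveI := isElliptic_congruentNumberCurve
    (Squarefree.ne_zero (squarefree_two_mul_prod_of_injective p hp hodd hinj))
  exact forall_bsdp_of_bsdTriple' _ (bsdTriple_of_monsky_of_smith_even p hM hS hp hodd hinj hdet).1
    2 Nat.prime_two

end Monsky

/-! ## §2 Where the pairs sit: CM by `ℤ[i]`, `2` ramified, rank `0` — cell status `coveredC8` -/

/-- Grid bookkeeping (kernel `decide`): a consistent CM cell with rank bit `0` has status
`coveredC8`. [folklore] -/
theorem status_eq_coveredC8_of_cm_ne_none (c : CellAtTwo) (hc : c.Consistent = true)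
    (hk : c.cm ≠ .none) (hr : c.r1 = false) : c.status = .coveredC8 := by
  revert c; decide +kernel

/-- **The pairs live in `coveredC8` cells** — said plainly: for square-free `n` with
`#Sel₂(E_n) = 4` (what `det M = 1` certifies), `E_n` is CM with `j = 1728`, so `2` is RAMIFIED in
`ℚ(i)` (`cmAtTwoOf = ramified`), and of analytic rank `0` through the journal door
(`Smith2016.bsdTriple_congruentNumberCurve_of_cor13` fed with the DISCHARGED Cor 1.3,
`Smith2016.cor13_bsd_of_selmerRankTwo_of_burungaleTian_of_burungaleFlach hBT hH hBF`); hence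
`(cellAtTwoOf E_n).status = coveredC8`: the CLASS is covered by Burungale–Flach given `L(E,1) ≠ 0`,
and the doors replace that analytic input by a kernel `decide` on Monsky's matrix. No cell changes
status (CELLS160-STATUS.tsv v1.2 stands). [cite: BurungaleFlach2024, Cor. 2] [cite: BurungaleTian2026, Thm. 1.1] -/
theorem status_cellAtTwoOf_congruentNumberCurve_of_card_selmerGroup_two
    (hBT : burungaleTian_analyticRank_eq_zero_of_selmerCorank_eq_zero_of_hasCM)
    (hH : hasEntireLFunction_of_j_mem_maximalCMJInvariants)
    (hBF : bsdTriple_of_hasCM_of_L_one_ne_zero)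
    {n : ℕ} (hsq : Squarefree n) (hsel : Nat.card ((congruentNumberCurve n).selmerGroup 2) = 4) :
    haveI := isElliptic_congruentNumberCurve (Squarefree.ne_zero hsq)
    haveI := isGloballyMinimal_congruentNumberCurve hsq
    cmAtTwoOf (congruentNumberCurve n) = .ramified ∧ (congruentNumberCurve n).analyticRank = 0 ∧
      (cellAtTwoOf (congruentNumberCurve n)).status = .coveredC8 := by
  haveI := isElliptic_congruentNumberCurve (Squarefree.ne_zero hsq)
  haveI := isGloballyMinimal_congruentNumberCurve hsq
  obtain ⟨-, -, hr0⟩ := Smith2016.bsdTriple_congruentNumberCurve_of_cor13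
    (Smith2016.cor13_bsd_of_selmerRankTwo_of_burungaleTian_of_burungaleFlach hBT hH hBF) hsq hsel
  have hj : (congruentNumberCurve n).j = 1728 := congruentNumberCurve_j n
  have hcm : (congruentNumberCurve n).HasCM := hasCM_of_j_eq_1728 _ hj
  have hram : CMRamified (congruentNumberCurve n) 2 := by
    show (2 : ℤ) ∣ cmFieldDiscrOfJ (congruentNumberCurve n).j
    rw [hj, cmFieldDiscrOfJ]; norm_num
  have hk : cmAtTwoOf (congruentNumberCurve n) = .ramified := by
    unfold cmAtTwoOf
    rw [if_neg (not_not_intro hcm), if_neg (fun h : CMSplit _ 2 => h.1 hram), if_pos hram]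
  refine ⟨hk, hr0, status_eq_coveredC8_of_cm_ne_none _
    (consistent_cellAtTwoOf (congruentNumberCurve n) (by rw [hr0]; exact zero_le_one)) ?_ ?_⟩
  · show cmAtTwoOf (congruentNumberCurve n) ≠ .none
    rw [hk]; decide
  · show decide ((congruentNumberCurve n).analyticRank = 1) = false
    rw [hr0]; decide

/-! ## §3 Kernel helper for the instance files -/

/-- `(3 : ℤ/2) = 1` — the diagonal sums of Monsky's matrix are read modulo `2` (used, with Mathlib's
`CharTwo.two_eq_zero`, by the instance files' `norm_num` calls, which otherwise leave the numerals
`2`, `3`). [folklore] -/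
theorem three_eq_one_zmod_two : (3 : ZMod 2) = 1 := by decide

end Summit.BirchSwinnertonDyer.Rank1Residual.P2

end
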